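import Mathlib
import HarnessLib
import Summits.HubbardSuperconductivity.HubbardSuperconductivity.Theorems.KLProgrammeC4aPPKernelPiecesJetsAllOrders

/-!
# Route `KLProgramme` — crux C4a, S3 brick (B4) «(B4)-UMK1», «PIECES ALL ORDERS» part 4: the HYPOTHESIS-FREE one-calls — the order-`k` rows of `P/C`, `A_s/C`, `M_s/C`
# for the tree's concrete cutoff `χ₂ = salmhoferCutoff` (Gevrey table `8(k!)²342ᵏ`) and concrete profile `κ = ppSplitProfile t₁` (table `8(k!)²(512/t₁)ᵏ`)

Cell `gate-hubbard-kl`, seat hubbard-kl-k3c3-p1 (g20; row «δμ-flow with klAngularMean constant piece»).  The `…Split` twins of `ppTrueKernel_orderRows` (`…TrueJetsJoint`),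
`ppFarKernelS_orderRows`, `ppMidKernelS_orderRows` (`…PiecesJetsAllOrders`): every abstract table discharged by the Literature Gevrey-2 numerals
(`salmhoferCutoff_jets_le_flat`, `ppSplitProfile_jetTable`, `ppSplitProfile_hyps`), so the only data left are `β, Λ, lo, hi, K, t₁, k` and a normalisation `C` above an
explicit closed form:
* **`ppTrueKernel_orderRows_gevrey`** — `C ≥ (k+1)!·2^{2k+2}·(1 + 8(k!)²342ᵏ)·K^{k+1}`;
* **`ppFarKernelSSplit_orderRows`** — `C ≥ 2ᵏ·(k+1)!·2^{2k+2}·(1 + 8(k!)²342ᵏ)·K^{k+1}·B_split`, `B_split = k!·(8(k!)²(512/t₁)ᵏ)·((k!)²·4/t₁)ᵏ`;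
* **`ppMidKernelSSplit_orderRows`** — the same with `1 + 2B_split`.
Each gives: `C^k` in `u` ∧ `∀ j ≤ k` joint continuity of `∂ᵤʲ(·/C)` ∧ `|∂ᵤʲ(·/C)(e,u)| ≤ (max |e| |u|)⁻¹^(j+1)` on the box `|e| ≤ hi ≤ K·Λ`, `e ≠ 0` ∧ `≤ (max lo |u|)⁻¹^(j+1)` on the
strip `|e| ≤ lo ≤ Λ` (`0 < t₁ ≤ 2/3`).  The numerals are crude by design (Gevrey tables); sharp `sup|χ₂⁽ˡ⁾|`, `sup|smoothTransition⁽ˡ⁾|` are a certified-numerics item.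
Pure composition; nothing asserts (C), any engine row, K3, the window or superconductivity.
References: BGM 2006 §2.4 (2.36) [cite: BenfattoGiulianiMastropietro2006]; Disertori–Rivasseau 2000 §II.2 (II.14) footnote [cite: DisertoriRivasseau2000].
-/

noncomputable section

namespace Summit.HubbardSuperconductivity.HubbardSuperconductivity.Theorems.C4a

set_option linter.dupNamespace false -- summit = problem name (single-conjunct summit), D-0017

open Real Filter Set Finset
open scoped Topology Nat
open Literature.MathematicalPhysics.QuantumLattice Literature.Analysis.SpecialFunctions Literature.Analysis.Calculus

/-- **`P/C`, hypothesis-free**: the order-`k` rows of `ppTrueKernel_orderRows` with the Gevrey cutoff table `X = 8(k!)²342ᵏ`. [cite: BenfattoGiulianiMastropietro2006, §2.4 (2.36)] -/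
theorem ppTrueKernel_orderRows_gevrey {β Λ : ℝ} (hβ : 0 < β) (hΛ : 0 < Λ) (k : ℕ) {lo hi K C : ℝ} (hlo : 0 < lo) (hloΛ : lo ≤ Λ) (hK : 1 ≤ K)
    (hhiK : hi ≤ K * Λ) (hC : 0 < C) (hCk : (k + 1)! * 2 ^ (2 * k + 2) * (1 + 8 * ((k ! : ℝ)) ^ 2 * (342 : ℝ) ^ k) * K ^ (k + 1) ≤ C) :
    (∀ e : ℝ, ContDiff ℝ k (fun v : ℝ => ppTrueKernel β Λ e v / C)) ∧
      (∀ j ≤ k, Continuous fun p : ℝ × ℝ => iteratedDeriv j (fun v : ℝ => ppTrueKernel β Λ p.1 v / C) p.2) ∧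
      (∀ j ≤ k, ∀ e ∈ Icc (-hi) hi, e ≠ 0 → ∀ u : ℝ, |iteratedDeriv j (fun v : ℝ => ppTrueKernel β Λ e v / C) u| ≤ (max |e| |u|)⁻¹ ^ (j + 1)) ∧
      (∀ j ≤ k, ∀ e ∈ Icc (-lo) lo, ∀ u : ℝ, |iteratedDeriv j (fun v : ℝ => ppTrueKernel β Λ e v / C) u| ≤ (max lo |u|)⁻¹ ^ (j + 1)) :=
  ppTrueKernel_orderRows hβ hΛ (salmhoferCutoff_jets_le_flat k) hlo hloΛ hK hhiK hC hCk

/-- **`A_s/C` for the concrete profile, hypothesis-free** (`κ = ppSplitProfile t₁`, `0 < t₁ ≤ 2/3`). [cite: BenfattoGiulianiMastropietro2006, §2.4 (2.36)] -/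
theorem ppFarKernelSSplit_orderRows {β Λ : ℝ} (hβ : 0 < β) (hΛ : 0 < Λ) {lo : ℝ} (hlo : 0 < lo) {t₁ : ℝ} (ht₀ : 0 < t₁) (ht23 : t₁ ≤ 2 / 3) (k : ℕ)
    {hi K C : ℝ} (hloΛ : lo ≤ Λ) (hK : 1 ≤ K) (hhiK : hi ≤ K * Λ) (hC : 0 < C)
    (hCk : 2 ^ k * ((k + 1)! * 2 ^ (2 * k + 2) * (1 + 8 * ((k ! : ℝ)) ^ 2 * (342 : ℝ) ^ k) * K ^ (k + 1)) *
      (k ! * (8 * ((k ! : ℝ)) ^ 2 * (512 / t₁) ^ k) * (((k ! : ℝ)) ^ 2 * (4 / t₁)) ^ k) ≤ C) :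
    (∀ e : ℝ, ContDiff ℝ k (fun v : ℝ => ppFarKernelS β Λ (ppSplitProfile t₁) lo e v / C)) ∧
      (∀ j ≤ k, Continuous fun p : ℝ × ℝ => iteratedDeriv j (fun v : ℝ => ppFarKernelS β Λ (ppSplitProfile t₁) lo p.1 v / C) p.2) ∧
      (∀ j ≤ k, ∀ e ∈ Icc (-hi) hi, e ≠ 0 → ∀ u : ℝ,
        |iteratedDeriv j (fun v : ℝ => ppFarKernelS β Λ (ppSplitProfile t₁) lo e v / C) u| ≤ (max |e| |u|)⁻¹ ^ (j + 1)) ∧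
      (∀ j ≤ k, ∀ e ∈ Icc (-lo) lo, ∀ u : ℝ,
        |iteratedDeriv j (fun v : ℝ => ppFarKernelS β Λ (ppSplitProfile t₁) lo e v / C) u| ≤ (max lo |u|)⁻¹ ^ (j + 1)) := by
  obtain ⟨hκ, h1, h0⟩ := ppSplitProfile_hyps ht₀
  exact ppFarKernelS_orderRows hβ hΛ hlo hκ ht₀ ht23 h1 h0 (salmhoferCutoff_jets_le_flat k) (ppSplitProfile_jetTable ht₀ (by linarith) k)
    hloΛ hK hhiK hC hCk

/-- **`M_s/C` for the concrete profile, hypothesis-free** (`κ = ppSplitProfile t₁`, `0 < t₁ ≤ 2/3`). [cite: BenfattoGiulianiMastropietro2006, §2.4 (2.36)] -/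
theorem ppMidKernelSSplit_orderRows {β Λ : ℝ} (hβ : 0 < β) (hΛ : 0 < Λ) {lo : ℝ} (hlo : 0 < lo) {t₁ : ℝ} (ht₀ : 0 < t₁) (ht23 : t₁ ≤ 2 / 3) (k : ℕ)
    {hi K C : ℝ} (hloΛ : lo ≤ Λ) (hK : 1 ≤ K) (hhiK : hi ≤ K * Λ) (hC : 0 < C)
    (hCk : 2 ^ k * ((k + 1)! * 2 ^ (2 * k + 2) * (1 + 8 * ((k ! : ℝ)) ^ 2 * (342 : ℝ) ^ k) * K ^ (k + 1)) *
      (1 + 2 * (k ! * (8 * ((k ! : ℝ)) ^ 2 * (512 / t₁) ^ k) * (((k ! : ℝ)) ^ 2 * (4 / t₁)) ^ k)) ≤ C) :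
    (∀ e : ℝ, ContDiff ℝ k (fun v : ℝ => ppMidKernelS β Λ (ppSplitProfile t₁) lo e v / C)) ∧
      (∀ j ≤ k, Continuous fun p : ℝ × ℝ => iteratedDeriv j (fun v : ℝ => ppMidKernelS β Λ (ppSplitProfile t₁) lo p.1 v / C) p.2) ∧
      (∀ j ≤ k, ∀ e ∈ Icc (-hi) hi, e ≠ 0 → ∀ u : ℝ,
        |iteratedDeriv j (fun v : ℝ => ppMidKernelS β Λ (ppSplitProfile t₁) lo e v / C) u| ≤ (max |e| |u|)⁻¹ ^ (j + 1)) ∧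
      (∀ j ≤ k, ∀ e ∈ Icc (-lo) lo, ∀ u : ℝ,
        |iteratedDeriv j (fun v : ℝ => ppMidKernelS β Λ (ppSplitProfile t₁) lo e v / C) u| ≤ (max lo |u|)⁻¹ ^ (j + 1)) := by
  obtain ⟨hκ, h1, h0⟩ := ppSplitProfile_hyps ht₀
  exact ppMidKernelS_orderRows hβ hΛ hlo hκ ht₀ ht23 h1 h0 (salmhoferCutoff_jets_le_flat k) (ppSplitProfile_jetTable ht₀ (by linarith) k)
    hloΛ hK hhiK hC hCk

end Summit.HubbardSuperconductivity.HubbardSuperconductivity.Theorems.C4a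

end
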